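import Mathlib.Analysis.SpecialFunctions.Trigonometric.DerivHyp
import Mathlib.Analysis.SpecialFunctions.Exp
import Mathlib.LinearAlgebra.BilinearMap
import Mathlib.Tactic.Module
import Mathlib.Tactic.FieldSimp
import Mathlib.Tactic.Linarith
import Mathlib.Tactic.LinearCombination

/-!
# SoloInformed — the exact metric of a boosted tube over a planar core (kernel shadow of EXHAUST.md §7)

Soloist `solo-FinalStateConjecture-informed` (session 32, 2026-08-19). Companion to paper/EXHAUST.md §7
(ERRATUM 3′: domain-coiled boosted tentacles) of the soloist's audit of clause (ii) of
`HasExhaustiveCharts` in the typed Final State Conjecture.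

The witnesses of EXHAUST §7.3 glue thin tubes to the mandated far leaf of a flat chart; on a tube the
chart is `S ∘ Φ ∘ Ψ⁻¹` with `S` the static chart of Schwarzschild and `Φ`, `Ψ` TUBE MAPS over planar
cores.  Everything typed-clause-relevant about such a tube (its `C⁰/C¹/C²` distance from the flat
metric) follows from ONE closed formula, LEMMA T1 of EXHAUST §7.2, whose algebraic and
differential content is checked here over an abstract real vector space:

* **Frame transport** (`hasDerivAt_E₁`, `hasDerivAt_E₀`, `hasDerivAt_E₂`).  For a planar unit-speed
  core with tangent `T`, in-plane normal `n` (`T′ = k n`, `n′ = −k T` in arc length `σ`), a rapidity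
  function `Y(s)` and the reparametrisation `σ′ = cosh Y`, the boosted frame
  `E₁ = sinh Y ∂ₜ + cosh Y T`, `E₀ = cosh Y ∂ₜ + sinh Y T`, `E₂ = n` satisfies
  `E₁′ = Y′ E₀ + k cosh²Y E₂`, `E₀′ = Y′ E₁ + k sinh Y cosh Y E₂`,
  `E₂′ = k sinh Y cosh Y E₀ − k cosh²Y E₁`.
* **Pulled-back metric** (`tube_gss`, `tube_gs0`, `tube_gs2`, `frame_table`).  With
  `∂ₛΦ = A E₁ + B (y⁰ E₂ + y² E₀)` and any symmetric bilinear form for which `(∂ₜ, T, n)` is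
  Lorentz-orthonormal, `η(∂ₛΦ, ∂ₛΦ) = A² + B²((y⁰)² − (y²)²)`, `η(∂ₛΦ, E₀) = −B y²`,
  `η(∂ₛΦ, E₂) = B y⁰` — the display of EXHAUST §7.2 (the earlier §4 display omitted the `B` terms).
* **Curved part** (`schwarzschild_f_le`, `schwarzschild_df_le`, `schwarzschild_ddf_le`): the radial
  coefficient `f = 2M/(r − 2M)` of `S*g − η` and its first two derivatives are bounded by `4M/r`,
  `8M/r²`, `32M/r³` on `r ≥ 4M` (LEMMA T2).
* **Focal algebra of the injectivity proof** (`focal_identity`, `focal_lower_bound`,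
  `focal_rigid`): the two null-coordinate equations of a self-intersection on the ray force the
  label offset to be at least `(s′ − s)/(e^{ΔY} − 1)` (LEMMA T3, region I).

No Lorentzian geometry of the tree is used; the file is self-contained real analysis and linear
algebra, landed so that the constants of EXHAUST §7 rest on checked identities.
-/

noncomputable section

open Real

namespace Summit.FinalStateConjecture.FinalStateConjecture.Theorems

namespace TubeMetric

variable {V : Type*} [NormedAddCommGroup V] [NormedSpace ℝ V]

/-! ### Frame transport along a boosted planar core -/

section Frame

variable (et : V) (T n : ℝ → V) (k : ℝ → ℝ) (Y σf : ℝ → ℝ)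

/-- The unit tangent of the boosted core: `E₁(s) = sinh Y(s) ∂ₜ + cosh Y(s) T(σ(s))`. -/
def E₁ (s : ℝ) : V := Real.sinh (Y s) • et + Real.cosh (Y s) • T (σf s)

/-- The boosted unit timelike normal: `E₀(s) = cosh Y(s) ∂ₜ + sinh Y(s) T(σ(s))`. -/
def E₀ (s : ℝ) : V := Real.cosh (Y s) • et + Real.sinh (Y s) • T (σf s)

/-- The in-plane normal transported along the core: `E₂(s) = n(σ(s))`. -/
def E₂ (s : ℝ) : V := n (σf s)

variable {et T n k Y σf}

/-- `E₁′ = Y′ E₀ + k cosh²Y E₂` (EXHAUST §7.2, LEMMA T1, first identity). Hypotheses: the planar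
Frenet equations `T′ = k n` at `σ(s)`, the rapidity derivative `Y′(s) = Y'`, and the
reparametrisation `σ′(s) = cosh Y(s)`. -/
theorem hasDerivAt_E₁ {s Y' : ℝ} (hT : HasDerivAt T (k (σf s) • n (σf s)) (σf s))
    (hY : HasDerivAt Y Y' s) (hσ : HasDerivAt σf (Real.cosh (Y s)) s) :
    HasDerivAt (E₁ et T Y σf)
      (Y' • E₀ et T Y σf s + (k (σf s) * Real.cosh (Y s) * Real.cosh (Y s)) • E₂ n σf s) s := by
  have h1 : HasDerivAt (fun x => Real.sinh (Y x)) (Real.cosh (Y s) * Y') s :=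
    (Real.hasDerivAt_sinh (Y s)).comp s hY
  have h2 : HasDerivAt (fun x => Real.cosh (Y x)) (Real.sinh (Y s) * Y') s :=
    (Real.hasDerivAt_cosh (Y s)).comp s hY
  have h3 : HasDerivAt (fun x => T (σf x)) (Real.cosh (Y s) • (k (σf s) • n (σf s))) s :=
    hT.scomp s hσ
  have h4 : HasDerivAt (E₁ et T Y σf)
      ((Real.cosh (Y s) * Y') • et
        + (Real.cosh (Y s) • (Real.cosh (Y s) • (k (σf s) • n (σf s)))
          + (Real.sinh (Y s) * Y') • T (σf s))) s :=
    (h1.smul_const et).add (h2.smul h3)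
  refine h4.congr_deriv ?_
  simp only [E₀, E₂, smul_add, smul_smul]
  module

/-- `E₀′ = Y′ E₁ + k sinh Y cosh Y E₂` (LEMMA T1, second identity). -/
theorem hasDerivAt_E₀ {s Y' : ℝ} (hT : HasDerivAt T (k (σf s) • n (σf s)) (σf s))
    (hY : HasDerivAt Y Y' s) (hσ : HasDerivAt σf (Real.cosh (Y s)) s) :
    HasDerivAt (E₀ et T Y σf)
      (Y' • E₁ et T Y σf s + (k (σf s) * Real.sinh (Y s) * Real.cosh (Y s)) • E₂ n σf s) s := by
  have h1 : HasDerivAt (fun x => Real.sinh (Y x)) (Real.cosh (Y s) * Y') s :=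
    (Real.hasDerivAt_sinh (Y s)).comp s hY
  have h2 : HasDerivAt (fun x => Real.cosh (Y x)) (Real.sinh (Y s) * Y') s :=
    (Real.hasDerivAt_cosh (Y s)).comp s hY
  have h3 : HasDerivAt (fun x => T (σf x)) (Real.cosh (Y s) • (k (σf s) • n (σf s))) s :=
    hT.scomp s hσ
  have h4 : HasDerivAt (E₀ et T Y σf)
      ((Real.sinh (Y s) * Y') • et
        + (Real.sinh (Y s) • (Real.cosh (Y s) • (k (σf s) • n (σf s)))
          + (Real.cosh (Y s) * Y') • T (σf s))) s :=
    (h2.smul_const et).add (h1.smul h3)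
  refine h4.congr_deriv ?_
  simp only [E₁, E₂, smul_add, smul_smul]
  module

/-- `E₂′ = k sinh Y cosh Y E₀ − k cosh²Y E₁` (LEMMA T1, third identity; uses `n′ = −k T` and
`T = cosh Y E₁ − sinh Y E₀`, i.e. `cosh² − sinh² = 1`). -/
theorem hasDerivAt_E₂ {s : ℝ} (hn : HasDerivAt n (-(k (σf s)) • T (σf s)) (σf s))
    (hσ : HasDerivAt σf (Real.cosh (Y s)) s) :
    HasDerivAt (E₂ n σf)
      ((k (σf s) * Real.sinh (Y s) * Real.cosh (Y s)) • E₀ et T Y σf s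
        - (k (σf s) * Real.cosh (Y s) * Real.cosh (Y s)) • E₁ et T Y σf s) s := by
  have h3 : HasDerivAt (E₂ n σf) (Real.cosh (Y s) • ((-(k (σf s))) • T (σf s))) s :=
    hn.scomp s hσ
  have hc2 : Real.cosh (Y s) ^ 2 = Real.sinh (Y s) ^ 2 + 1 := Real.cosh_sq (Y s)
  refine h3.congr_deriv ?_
  simp only [E₀, E₁, smul_add, smul_smul, neg_smul, smul_neg]
  match_scalars <;>
    first
      | linear_combination (-(k (σf s) * Real.cosh (Y s))) * hc2
      | linear_combination (k (σf s) * Real.cosh (Y s)) * hc2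
      | ring1

end Frame

/-! ### The pulled-back metric (LEMMA T1, closed form) -/

section Metric

variable (η : V →ₗ[ℝ] V →ₗ[ℝ] ℝ) (et Tv nv bv : V)

/-- Lorentz-orthonormality table of the spatial-static frame `(∂ₜ, T, n, b)` at one point:
`η(∂ₜ,∂ₜ) = −1`, the three spatial legs unit, all cross terms zero, `η` symmetric on the legs. -/
structure FrameTable : Prop where
  tt : η et et = -1
  TT : η Tv Tv = 1
  nn : η nv nv = 1
  bb : η bv bv = 1
  tT : η et Tv = 0
  Tt : η Tv et = 0
  tn : η et nv = 0
  nt : η nv et = 0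
  tb : η et bv = 0
  bt : η bv et = 0
  Tn : η Tv nv = 0
  nT : η nv Tv = 0
  Tb : η Tv bv = 0
  bT : η bv Tv = 0
  nb : η nv bv = 0
  bn : η bv nv = 0

variable {η et Tv nv bv}

/-- The boosted legs at one point, as vectors: `e₁ = sh ∂ₜ + ch T`, `e₀ = ch ∂ₜ + sh T` with
`ch² − sh² = 1`. -/
theorem frame_table (h : FrameTable η et Tv nv bv) (sh ch : ℝ) (hch : ch ^ 2 - sh ^ 2 = 1) :
    η (sh • et + ch • Tv) (sh • et + ch • Tv) = 1 ∧
    η (ch • et + sh • Tv) (ch • et + sh • Tv) = -1 ∧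
    η (sh • et + ch • Tv) (ch • et + sh • Tv) = 0 ∧
    η (sh • et + ch • Tv) nv = 0 ∧ η (ch • et + sh • Tv) nv = 0 := by
  obtain ⟨tt, TT, nn, bb, tT, Tt, tn, nt, tb, bt, Tn, nT, Tb, bT, nb, bn⟩ := h
  refine ⟨?_, ?_, ?_, ?_, ?_⟩ <;>
    simp only [map_add, map_smul, LinearMap.add_apply, LinearMap.smul_apply, smul_eq_mul,
      tt, TT, tT, Tt, tn, Tn] <;>
    first
      | linear_combination hch
      | linear_combination (-1 : ℝ) * hch
      | ring1

/-- LEMMA T1, the `ds²` coefficient: with `∂ₛΦ = A e₁ + B (y⁰ e₂ + y² e₀)`,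
`η(∂ₛΦ, ∂ₛΦ) = A² + B² ((y⁰)² − (y²)²)`. -/
theorem tube_gss (h : FrameTable η et Tv nv bv) (sh ch A B y0 y2 : ℝ) (hch : ch ^ 2 - sh ^ 2 = 1) :
    let e₁ := sh • et + ch • Tv
    let e₀ := ch • et + sh • Tv
    η (A • e₁ + B • (y0 • nv + y2 • e₀)) (A • e₁ + B • (y0 • nv + y2 • e₀))
      = A ^ 2 + B ^ 2 * (y0 ^ 2 - y2 ^ 2) := by
  obtain ⟨tt, TT, nn, bb, tT, Tt, tn, nt, tb, bt, Tn, nT, Tb, bT, nb, bn⟩ := h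
  simp only [map_add, map_smul, LinearMap.add_apply, LinearMap.smul_apply, smul_eq_mul,
    tt, TT, nn, tT, Tt, tn, nt, Tn, nT]
  linear_combination (A ^ 2 - B ^ 2 * y2 ^ 2) * hch

/-- LEMMA T1, the `ds dy⁰` coefficient: `η(∂ₛΦ, e₀) = −B y²`. -/
theorem tube_gs0 (h : FrameTable η et Tv nv bv) (sh ch A B y0 y2 : ℝ) (hch : ch ^ 2 - sh ^ 2 = 1) :
    let e₁ := sh • et + ch • Tv
    let e₀ := ch • et + sh • Tv
    η (A • e₁ + B • (y0 • nv + y2 • e₀)) e₀ = -(B * y2) := by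
  obtain ⟨tt, TT, nn, bb, tT, Tt, tn, nt, tb, bt, Tn, nT, Tb, bT, nb, bn⟩ := h
  simp only [map_add, map_smul, LinearMap.add_apply, LinearMap.smul_apply, smul_eq_mul,
    tt, TT, tT, Tt, nt, nT]
  linear_combination (-(B * y2)) * hch

/-- LEMMA T1, the `ds dy²` coefficient: `η(∂ₛΦ, e₂) = B y⁰`. -/
theorem tube_gs2 (h : FrameTable η et Tv nv bv) (sh ch A B y0 y2 : ℝ) :
    let e₁ := sh • et + ch • Tv
    let e₀ := ch • et + sh • Tv
    η (A • e₁ + B • (y0 • nv + y2 • e₀)) nv = B * y0 := by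
  obtain ⟨tt, TT, nn, bb, tT, Tt, tn, nt, tb, bt, Tn, nT, Tb, bT, nb, bn⟩ := h
  simp only [map_add, map_smul, LinearMap.add_apply, LinearMap.smul_apply, smul_eq_mul,
    nn, tn, Tn]
  ring

/-- LEMMA T1, the `ds dy³` coefficient vanishes and `(e₀, e₂, e₃)` stay Lorentz-orthonormal:
the remaining entries of `Φ*η` are those of the flat metric. -/
theorem tube_gs3 (h : FrameTable η et Tv nv bv) (sh ch A B y0 y2 : ℝ) :
    let e₁ := sh • et + ch • Tv
    let e₀ := ch • et + sh • Tv
    η (A • e₁ + B • (y0 • nv + y2 • e₀)) bv = 0 ∧ η nv bv = 0 ∧ η bv bv = 1 ∧ η nv nv = 1 := by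
  obtain ⟨tt, TT, nn, bb, tT, Tt, tn, nt, tb, bt, Tn, nT, Tb, bT, nb, bn⟩ := h
  refine ⟨?_, nb, bb, nn⟩
  simp only [map_add, map_smul, LinearMap.add_apply, LinearMap.smul_apply, smul_eq_mul,
    tb, Tb, nb]
  ring

/-- The `C⁰` size of the deviation is WIDTH × RATE: if `|A − 1| ≤ q`, `|B y⁰| ≤ q`, `|B y²| ≤ q`
and `q ≤ 1/2` then `|η(∂ₛΦ,∂ₛΦ) − 1| ≤ 3q` (EXHAUST §7.2, the bound `‖e‖_{C⁰} ≤ 3wκ`). -/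
theorem gss_sub_one_le (A B y0 y2 q : ℝ) (hA : |A - 1| ≤ q) (h0 : |B * y0| ≤ q)
    (h2 : |B * y2| ≤ q) (hq : q ≤ 1 / 2) :
    |A ^ 2 + B ^ 2 * (y0 ^ 2 - y2 ^ 2) - 1| ≤ 3 * q := by
  have hq0 : 0 ≤ q := le_trans (abs_nonneg _) hA
  have e1 : A ^ 2 - 1 = (A - 1) * (A - 1) + 2 * (A - 1) := by ring
  have e2 : B ^ 2 * (y0 ^ 2 - y2 ^ 2) = (B * y0) * (B * y0) - (B * y2) * (B * y2) := by ring
  rw [abs_le] at hA h0 h2 ⊢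
  obtain ⟨hA1, hA2⟩ := hA
  obtain ⟨h01, h02⟩ := h0
  obtain ⟨h21, h22⟩ := h2
  constructor <;> nlinarith [mul_nonneg hq0 hq0, sq_nonneg (A - 1), sq_nonneg (B * y0),
    sq_nonneg (B * y2)]

end Metric

/-! ### The curved part: the radial coefficient of `S*g − η` on `r ≥ 4M` (LEMMA T2) -/

section Curved

/-- `f = 2M/(r − 2M) ≤ 4M/r` for `r ≥ 4M`, `M ≥ 0`. -/
theorem schwarzschild_f_le (M r : ℝ) (hM : 0 ≤ M) (hr : 4 * M ≤ r) (hr0 : 0 < r) :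
    2 * M / (r - 2 * M) ≤ 4 * M / r := by
  have h1 : 0 < r - 2 * M := by linarith
  rw [div_le_div_iff₀ h1 hr0]
  nlinarith

/-- `|f′| = 2M/(r − 2M)² ≤ 8M/r²` for `r ≥ 4M`. -/
theorem schwarzschild_df_le (M r : ℝ) (hM : 0 ≤ M) (hr : 4 * M ≤ r) (hr0 : 0 < r) :
    2 * M / (r - 2 * M) ^ 2 ≤ 8 * M / r ^ 2 := by
  have h1 : 0 < r - 2 * M := by linarith
  have h2 : r ≤ 2 * (r - 2 * M) := by linarith
  rw [div_le_div_iff₀ (by positivity) (by positivity)]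
  have h3 : r ^ 2 ≤ 4 * (r - 2 * M) ^ 2 := by nlinarith
  nlinarith

/-- `f″ = 4M/(r − 2M)³ ≤ 32M/r³` for `r ≥ 4M`. -/
theorem schwarzschild_ddf_le (M r : ℝ) (hM : 0 ≤ M) (hr : 4 * M ≤ r) (hr0 : 0 < r) :
    4 * M / (r - 2 * M) ^ 3 ≤ 32 * M / r ^ 3 := by
  have h1 : 0 < r - 2 * M := by linarith
  have h2 : r ≤ 2 * (r - 2 * M) := by linarith
  rw [div_le_div_iff₀ (by positivity) (by positivity)]
  have h3 : r ^ 3 ≤ 8 * (r - 2 * M) ^ 3 := by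
    have := pow_le_pow_left₀ hr0.le h2 3
    nlinarith [this]
  nlinarith

/-- The derivative claims behind `schwarzschild_df_le`/`schwarzschild_ddf_le`:
`d/dr [2M/(r−2M)] = −2M/(r−2M)²`. -/
theorem hasDerivAt_schwarzschild_f (M r : ℝ) (hr : 2 * M < r) :
    HasDerivAt (fun x => 2 * M / (x - 2 * M)) (-(2 * M) / (r - 2 * M) ^ 2) r := by
  have h1 : r - 2 * M ≠ 0 := by linarith
  have hd : HasDerivAt (fun x => x - 2 * M) 1 r := (hasDerivAt_id r).sub_const _
  have h : HasDerivAt (fun x => 2 * M / (x - 2 * M))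
      ((0 * (r - 2 * M) - 2 * M * 1) / (r - 2 * M) ^ 2) r :=
    (hasDerivAt_const r (2 * M)).div hd h1
  refine h.congr_deriv ?_
  ring

/-- `d/dr [−2M/(r−2M)²] = 4M/(r−2M)³`. -/
theorem hasDerivAt_schwarzschild_df (M r : ℝ) (hr : 2 * M < r) :
    HasDerivAt (fun x => -(2 * M) / (x - 2 * M) ^ 2) (4 * M / (r - 2 * M) ^ 3) r := by
  have h1 : r - 2 * M ≠ 0 := by linarith
  have hd0 : HasDerivAt (fun x => x - 2 * M) 1 r := (hasDerivAt_id r).sub_const _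
  have hd : HasDerivAt (fun x => (x - 2 * M) ^ 2) (2 * (r - 2 * M)) r := by
    refine (hd0.pow 2).congr_deriv ?_
    norm_num
  have h : HasDerivAt (fun x => -(2 * M) / (x - 2 * M) ^ 2)
      ((0 * (r - 2 * M) ^ 2 - -(2 * M) * (2 * (r - 2 * M))) / ((r - 2 * M) ^ 2) ^ 2) r :=
    (hasDerivAt_const r (-(2 * M))).div hd (pow_ne_zero 2 h1)
  refine h.congr_deriv ?_
  rw [div_eq_div_iff (pow_ne_zero 2 (pow_ne_zero 2 h1)) (pow_ne_zero 3 h1)]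
  ring

end Curved

/-! ### Focal algebra of the injectivity proof on the ray (LEMMA T3, region I) -/

section Focal

/-- From the two null-coordinate equations of a coincidence `F(s, y⁰) = F(s′, y⁰′)` on the ray,
written with `p = −y⁰`, `q = −y⁰′`, `e₁ = e^{Y(s)} > 0`, `e₂ = e^{Y(s′)} > 0`, `I₋ = ∫ e^{−Y}`,
`I₊ = ∫ e^{Y}` and multiplied out — `U`: `p e₂ = I₋ e₁ e₂ + q e₁` (i.e. `p/e₁ = I₋ + q/e₂`),
`V`: `q e₂ = I₊ + p e₁` — one gets `p (e₂² − e₁²) = e₁ e₂² I₋ + e₁ I₊`, i.e.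
`p (1 − e₁²/e₂²) = e₁ I₋ + (e₁/e₂²) I₊` (EXHAUST §7.3 (I)). -/
theorem focal_identity (p q e₁ e₂ Im Ip : ℝ)
    (hU : p * e₂ = Im * e₁ * e₂ + q * e₁) (hV : q * e₂ = Ip + p * e₁) :
    p * (e₂ ^ 2 - e₁ ^ 2) = e₁ * e₂ ^ 2 * Im + e₁ * Ip := by
  linear_combination e₂ * hU + e₁ * hV

/-- The focal lower bound: if moreover `I₋ e₂ ≥ d` and `I₊ ≥ d e₁` (both integrands monotone,
`d = s′ − s ≥ 0`) and `0 < e₁ < e₂` (rapidity non-decreasing, not constant), then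
`p (e₂ − e₁) ≥ d e₁`, i.e. `|y⁰| ≥ (s′−s)/(e^{ΔY} − 1)` — larger than the label half-width in
CONSTRUCTION T′, so no coincidence occurs; for `e₁ = e₂` the identity gives `0 ≥ 2 d e₁²`, so
`d = 0`. -/
theorem focal_lower_bound (p q e₁ e₂ Im Ip d : ℝ) (he₁ : 0 < e₁) (he₁₂ : e₁ < e₂)
    (hU : p * e₂ = Im * e₁ * e₂ + q * e₁) (hV : q * e₂ = Ip + p * e₁)
    (hIm : d ≤ Im * e₂) (hIp : d * e₁ ≤ Ip) :
    d * e₁ ≤ p * (e₂ - e₁) := by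
  have hid := focal_identity p q e₁ e₂ Im Ip hU hV
  have h3 : d * (e₁ * e₂) ≤ e₁ * e₂ ^ 2 * Im := by
    have := mul_le_mul_of_nonneg_left hIm (le_of_lt (mul_pos he₁ (lt_trans he₁ he₁₂)))
    nlinarith [this]
  have h4 : d * e₁ ^ 2 ≤ e₁ * Ip := by nlinarith
  have h5 : d * e₁ * (e₂ + e₁) ≤ p * (e₂ - e₁) * (e₂ + e₁) := by nlinarith
  exact le_of_mul_le_mul_right h5 (by linarith)

/-- The degenerate case `e₁ = e₂` (constant rapidity between the two parameters): the identity
forces `d ≤ 0`, so a coincidence needs `s = s′`. -/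
theorem focal_rigid (p q e Im Ip d : ℝ) (he : 0 < e)
    (hU : p * e = Im * e * e + q * e) (hV : q * e = Ip + p * e)
    (hIm : d ≤ Im * e) (hIp : d * e ≤ Ip) : d ≤ 0 := by
  have hid := focal_identity p q e e Im Ip hU hV
  nlinarith [hid, mul_pos he he]

end Focal

end TubeMetric

end Summit.FinalStateConjecture.FinalStateConjecture.Theorems

end
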